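import Summits.BirchSwinnertonDyer.BirchSwinnertonDyer.Theorems.ByReductionTypeAtTwoSupersingularFlatCountClassKit
import Summits.BirchSwinnertonDyer.BirchSwinnertonDyer.Theorems.ByReductionTypeAtTwoSupersingularColemanClass100719a
import HarnessLib

/-!
# The ♭ integer-model kit on the `a₂ = 0` sub-row with the ♭ `Γ`-Euler characteristic at `2` DISCHARGED, and the
# `a₂ = 0` class `100719a` displayed on Sprung's ♭ road (no `h12`/`hKim` binder)

Seat `bsd-2adic-ss-1` GEN 10, crux `SupersingularRankZeroAtTwo` (item stmt-BirchSwinnertonDyer-19097, route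
`ByReductionTypeAtTwo`, rung K4), `a₂ = 0` sub-row (208 r0 classes; landed GEN 8 on Kobayashi's ± road,
`Theorems/ByReductionTypeAtTwoSupersingularColemanClass<cls>.lean`, with the READ-AT-2 binders `h12`, `hKim`, `hCK`
(CK±) — residue register {(LAG)⁺, F4@(2)}). Since the ♭ road's Kato half holds for EVERY `a₂ ∈ {0, ±2}`
(`missingUpperBoundAt_two_of_flatUpper`, `c♭ = 1` at `a₂ = 0`) and its `Γ`-Euler characteristic is PRODUCED in the
kernel (`flatEulerChar_two`, GEN 10), the `a₂ = 0` classes admit the SAME display as the `a₂ = ±2` ones: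
* `bsdp_two_baseChange_int_of_flatCountColemanKato_zero` — the kit (`#M̃(𝔽₂) = 3`);
* `bsdp_two_100719a1_of_flatCountColemanKato` — the class `100719a` in that currency, re-using the landed class
  file's kernel lemmas (`SSColemanRoad.M100719a1_*`, `card_F2_100719a1`).
A pricing ALTERNATIVE for the planner (v9 keeps the ± road on `a₂ = 0`; the uniform ♭ line
`…SupersingularUniformFlatLine.lean` is the matching ∀-composition). HONEST FRAMING: class-instance shapes; closes
nothing by itself; no census cell moves; BSD is not proved by any of this.

References: [Sprung2024] §5.2 Lemmas 5.5–5.9; [Sprung2012] Thm. 2.2 (2′), Lemma 2.3, Prop. 7.3, Thm. 7.14, 7.16,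
Prop. 7.19; [Sprung2017] Cor. 4.11; [Kato2004Asterisque] Thm. 12.4–12.5; [KuriharaOtsuki2006] p. 564;
[DokchitserDokchitserMathZ2012] Theorem; [SilvermanAEC2009] VII.5 Prop. 5.1(a); [Miller2011LMS] Def. 1.1;
[CremonaAlgorithms1997] Table 1 (100719a1).
-/

set_option autoImplicit false
-- the Theorems namespace of this sub repeats the summit name by design (D-0017 nested layout)
set_option linter.dupNamespace false

noncomputable section

open scoped Classical MatrixGroups ModularForm NumberField
open NumberField IsDedekindDomain CongruenceSubgroup WeierstrassCurve Literature.NumberTheory.EllipticCurves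
  Literature.NumberTheory.EllipticCurves.ModularForms Literature.NumberTheory.EllipticCurves.Sprung2017
  Literature.NumberTheory.EllipticCurves.Rank1Residual Literature.NumberTheory.EllipticCurves.Rank1Residual.Typed
  Literature.NumberTheory.EllipticCurves.Sprung2012 Literature.NumberTheory.EllipticCurves.IwasawaDual
  Literature.NumberTheory.EllipticCurves.Kobayashi2003 Literature.NumberTheory.GaloisRepresentations
  ZpExtension Summit.BirchSwinnertonDyer.Rank1Residual Summit.BirchSwinnertonDyer.Rank1Residual.Supersingular
  Summit.BirchSwinnertonDyer.Rank1Residual.X5 Summit.BirchSwinnertonDyer.Rank1Residual.X5.O1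
  Summit.BirchSwinnertonDyer.Rank1Residual.X5.Instances

namespace Summit.BirchSwinnertonDyer.BirchSwinnertonDyer.Theorems
namespace SSFlatRoad

/-! ## §1 The integer-model kit on the `a₂ = 0` sub-row, ♭ road, EC♭ discharged -/

/-- **`BSD(E, 2)` for `E = M ⊗ ℚ` ON THE ♭ COLEMAN ROAD, `a₂ = 0`, EC♭ DISCHARGED** — the class-instance shape of
crux `SupersingularRankZeroAtTwo` on the `a₂ = 0`, `2`-adically surjective classes (206/208) via Sprung's ♭ objects
(`c♭ = 1` at `a₂ = 0`; the Kato half `missingUpperBoundAt_two_of_flatUpper` holds for every `a₂ ∈ {0, ±2}`): the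
`a₂ = ±2` kit `bsdp_two_baseChange_int_of_flatCountColemanKato` with `#M̃(𝔽₂) = 3` (`a₂ = 0`,
`SSColemanRoad.goodSS_two_baseChange_int_of_card_three`). Compared with the ± kit
`SSColemanRoad.bsdp_two_baseChange_int_of_colemanKatoV5` of the 208 landed `a₂ = 0` class files, the READ-AT-2
binders `h12` (Kobayashi 1.2 @2) and `hKim` (Kim Cor. 3.15 @2, residue (LAG)⁺) are GONE — replaced by the Honda₂
clauses of the supplied ♭ data + COUNT♭@2 (+ CK♭ in place of CK±). KERNEL inputs: `Δ(M) = D` odd, `c₄(M) = C4`,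
`b`'s, `#M̃(𝔽₂) = 3`, `C4³/D = n/d`, Dokchitser–Dokchitser certificates `ℓ₁…ℓ₄`, `2^(m+1) ∤ Q`.
DISPLAYED: PRINT {`hmod`, `hGZK`, `h124`, `hX0`, `hDD`}; for the supplied `(κ, γ, v, g, c)`: PRINT-at-2/DERIVED
{levels, trace (`n ≥ 1`), gen₀(`c_0`)}; READ-AT-2 {COUNT♭@2, CK♭@2}; CERT {`L(E,1) ≠ 0`, `#Ш_an = Q`,
`2^m ∣ #Ш`}. Closes nothing by itself. [cite: Sprung2024, §5.2 Lemmas 5.5–5.9]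
[cite: Sprung2012, Thm. 2.2 (2′), Lemma 2.3, Prop. 7.3, Thm. 7.14, 7.16 and Prop. 7.19]
[cite: Kato2004Asterisque, Thm. 12.4–12.5] [cite: KuriharaOtsuki2006, p. 564]
[cite: DokchitserDokchitserMathZ2012, Theorem] [cite: SilvermanAEC2009, VII.5 Prop. 5.1(a)] [cite: Miller2011LMS, Def. 1.1] -/
theorem bsdp_two_baseChange_int_of_flatCountColemanKato_zero (M : WeierstrassCurve ℤ)
    {B₂ B₄ B₆ D C4 n d : ℤ} (hb₂ : M.b₂ = B₂) (hb₄ : M.b₄ = B₄) (hb₆ : M.b₆ = B₆) (hΔ : M.Δ = D)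
    (hc₄ : M.c₄ = C4) (h2 : ¬ (2 : ℤ) ∣ D)
    (hcard : Nat.card (M.map (Int.castRingHom (ZMod 2))).toAffine.Point = 3)
    (hd : d ≠ 0) (hnd : (C4 : ℚ) ^ 3 / (D : ℚ) = (n : ℚ) / (d : ℚ))
    {ℓ₁ ℓ₂ ℓ₃ ℓ₄ : ℕ} (hℓ₄ : 1 < ℓ₄)
    (h₁ : ∀ r : ZMod ℓ₁,
      r ^ 3 + (B₂ : ZMod ℓ₁) * r ^ 2 + ((8 * B₄ : ℤ) : ZMod ℓ₁) * r + ((16 * B₆ : ℤ) : ZMod ℓ₁) ≠ 0)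
    (h₂ : ∀ r : ZMod ℓ₂, r * r ≠ ((|D| : ℤ) : ZMod ℓ₂))
    (h₃ : ∀ r : ZMod ℓ₃, r * r ≠ ((2 * |D| : ℤ) : ZMod ℓ₃))
    (h₄ : ∀ a b : ZMod ℓ₄, (a ≠ 0 ∨ b ≠ 0) →
      4 * (d : ZMod ℓ₄) * a ^ 4 + 32 * (d : ZMod ℓ₄) * a ^ 3 * b + (n : ZMod ℓ₄) * b ^ 4 ≠ 0)
    {Q m : ℕ} (hQ : Q ≠ 0) (hQm : ¬ 2 ^ (m + 1) ∣ Q)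
    (hmod : nonempty_modularParametrizationData)
    (hGZK : rank_eq_analyticRank_of_analyticRank_le_one)
    (h124 : Kato2004.thm12_4) (hX0 : Kato2004_fineSelmerDual_isTorsion)
    (hDD : DokchitserDokchitser2012_surjective_mod_two_four_eight) :
    ∀ (W : WeierstrassCurve ℚ) [W.IsElliptic] [W.IsGloballyMinimal], W = M.baseChange ℚ →
    ∀ (κ : ZpExtension ℚ 2) (γ : Field.absoluteGaloisGroup ℚ), κ.IsCyclotomic → κ.IsTopGenerator γ →
    ∀ (v : HeightOneSpectrum (𝓞 ℚ)), (2 : 𝓞 ℚ) ∈ v.asIdeal →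
    ∀ (g : Field.absoluteGaloisGroup (v.adicCompletion ℚ)) (c : ℕ → localPoints W (v.adicCompletion ℚ)),
      κ.IsTopGenerator (resGalOfEmb (closureEmb (K := ℚ) (v.adicCompletion ℚ)) g) →
    (∀ n, c n ∈ localLayerPointsOfEmb κ (closureEmb (K := ℚ) (v.adicCompletion ℚ)) W n) →
    (∀ n, 1 ≤ n → localTraceOfEmb κ (closureEmb (K := ℚ) (v.adicCompletion ℚ)) W n (n + 1)
      (c (n + 1)) = W.frobeniusTrace 2 • c n - c (n - 1)) →
    (∀ z₀ : localLayerPointsOfEmb κ (closureEmb (K := ℚ) (v.adicCompletion ℚ)) W 0 →+ ℤ_[2],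
      evalOn W (localLayerPointsOfEmb κ (closureEmb (K := ℚ) (v.adicCompletion ℚ)) W 0) z₀ (c 0) = 0 →
        z₀ = 0) →
    (∀ a : ℤ_[2],
      (∃ z₀ : localLayerPointsOfEmb κ (closureEmb (K := ℚ) (v.adicCompletion ℚ)) W 0 →+ ℤ_[2],
        evalOn W (localLayerPointsOfEmb κ (closureEmb (K := ℚ) (v.adicCompletion ℚ)) W 0) z₀ (c 0) =
          2 * a) →
      ∃ y : localLayerPointsOfEmb κ (closureEmb (K := ℚ) (v.adicCompletion ℚ)) W 0 →+ ℤ_[2],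
        evalOn W (localLayerPointsOfEmb κ (closureEmb (K := ℚ) (v.adicCompletion ℚ)) W 0) y (c 0) = a) →
    (Finite (W.selmerGroupPInfty 2) →
      Finite (EndCoinvariants (conjSharpFlatSelmerInfty W κ (closureEmb (K := ℚ) (v.adicCompletion ℚ))
        (W.frobeniusTrace 2) g c .flat γ - 1)) →
      Nat.card (↥((sharpFlatSelmerInfty W κ (closureEmb (K := ℚ) (v.adicCompletion ℚ))
            (W.frobeniusTrace 2) g c .flat).comap (W.layerToInfty κ 0)) ⧸
          (W.selmerLayer κ 0).addSubgroupOf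
            ((sharpFlatSelmerInfty W κ (closureEmb (K := ℚ) (v.adicCompletion ℚ))
              (W.frobeniusTrace 2) g c .flat).comap (W.layerToInfty κ 0))) *
        Nat.card (MulAction.fixedPoints (Field.absoluteGaloisGroup ℚ) (W.geomPrimaryTorsion 2)) =
      2 ^ (padicValNat 2 W.tamagawaProduct) *
        Nat.card (EndCoinvariants (conjSharpFlatSelmerInfty W κ
          (closureEmb (K := ℚ) (v.adicCompletion ℚ)) (W.frobeniusTrace 2) g c .flat γ - 1))) →
    (∀ [NeZero (W.conductorNorm ℤ)] (f : CuspForm (Gamma0 (W.conductorNorm ℤ)) 2),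
        IsNewformOf W f → ∀ (ϖ : ℚ), (ϖ : ℝ) * W.realPeriodRat = plusPeriod f →
      ∀ (Ls Lf : IwasawaAlgebra 2), IsSprungPair f 2 (W.frobeniusTrace 2) Ls Lf →
      ∀ (D : SharpFlatSelmerDualData W κ γ (closureEmb (K := ℚ) (v.adicCompletion ℚ))
          (W.frobeniusTrace 2) g c .flat)
        [ContinuousSMul ℤ_[2] (W.tateModule 2)],
        ∃ (I : Kato2004.IwasawaH1Data W 2 κ γ) (Y : W.FineSelmerDualData κ γ)
          (P : Submodule (IwasawaAlgebra 2) (IwasawaAlgebra 2))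
          (loc : I.H →ₗ[IwasawaAlgebra 2] P) (toX : P →ₗ[IwasawaAlgebra 2] D.X)
          (δ : D.X →ₗ[IwasawaAlgebra 2] Y.X) (Z : Submodule (IwasawaAlgebra 2) I.H)
          (G : IwasawaAlgebra 2),
          Function.Exact loc toX ∧ Function.Exact toX δ ∧
          G ∈ Submodule.map (P.subtype ∘ₗ loc) Z ∧
          iwasawaToPowerSeries 2 G = PowerSeries.C (ϖ : ℚ_[2]) * iwasawaToPowerSeries 2 Lf ∧
          (∀ 𝔭 : PrimeSpectrum (IwasawaAlgebra 2), 𝔭.asIdeal.height = 1 →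
            PowerSeries.C (2 : ℤ_[2]) ∉ 𝔭.asIdeal →
            Literature.NumberTheory.EllipticCurves.Module.lengthAt (IwasawaAlgebra 2) Y.X 𝔭 ≤
              Literature.NumberTheory.EllipticCurves.Module.lengthAt (IwasawaAlgebra 2) (I.H ⧸ Z) 𝔭) ∧
          (TwoAdicSurjective W →
            ∀ 𝔭 : PrimeSpectrum (IwasawaAlgebra 2), 𝔭.asIdeal.height = 1 →
              PowerSeries.C (2 : ℤ_[2]) ∈ 𝔭.asIdeal →
              Literature.NumberTheory.EllipticCurves.Module.lengthAt (IwasawaAlgebra 2) Y.X 𝔭 ≤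
                Literature.NumberTheory.EllipticCurves.Module.lengthAt (IwasawaAlgebra 2) (I.H ⧸ Z) 𝔭)) →
    W.entireLFunction 1 ≠ 0 → shaAn W = ((Q : ℚ) : ℂ) → 2 ^ m ∣ W.shaOrder → BSDp W 2 := by
  intro W _ _ hW κ γ hκ hγ v hv g c hg hc hTr hinj hsat hcount hCK hL hq hdvd
  subst hW
  obtain ⟨hgood, ha, hss⟩ := SSColemanRoad.goodSS_two_baseChange_int_of_card_three M (by rwa [hΔ]) hcard
  exact bsdp_two_of_flatCountColemanKato_of_pow_dvd _ g c hmod hGZK h124 hX0 hgood hss.2 hL hκ hγ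
    (SSColemanRoad.twoAdicSurjective_baseChange_int_of_certificates M hDD hb₂ hb₄ hb₆ hΔ hc₄ hd hnd hℓ₄
      h₁ h₂ h₃ h₄)
    hv hg hc hTr hinj hsat hcount hCK hq (SSColemanRoad.padicValRat_two_natCast_le hQ hQm) hdvd

/-! ## §2 The `a₂ = 0` class `100719a` on the ♭ road -/

/-- **`BSD(100719a1, 2)` ON THE ♭ COLEMAN ROAD (`a₂ = 0`), EC♭ DISCHARGED** — the `a₂ = 0` class `100719a`
(`100719a1 = [0, 0, 1, −40372074, −98734675687]`, `N = 100719`; landed on the ± road as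
`SSColemanRoad.bsdp_two_100719a1_of_colemanKatoV5`) displayed on Sprung's ♭ road instead: PRINT {`hmod`, `hGZK`,
`h124`, `hX0`, `hDD`}; for the supplied `(κ, γ, v ∋ 2, g, c)`: {levels, trace (`n ≥ 1`), gen₀(`c_0`)}, READ-AT-2
{COUNT♭@2, CK♭@2}; CERT {`L(E,1) ≠ 0`, `#Ш_an = 16`, `2^4 ∣ #Ш`} — NO `h12`/`hKim` binder. KERNEL (from the landed
class file `…ColemanClass100719a.lean`): `Δ = 10362911611416093`, `c₄`, `b`'s, `2 ∤ Δ`, `#Ẽ(𝔽₂) = 3`, `j` not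
integral, DD certificates `ℓ = 7, 5, 4, 5`, `2^5 ∤ 16`. Closes nothing by itself.
[cite: Sprung2012, Thm. 2.2, Thm. 7.14, 7.16 and Prop. 7.19] [cite: Sprung2024, §5.2 Lemmas 5.5–5.9]
[cite: Kato2004Asterisque, Thm. 12.4–12.5] [cite: KuriharaOtsuki2006, p. 564] [cite: DokchitserDokchitserMathZ2012, Theorem]
[cite: CremonaAlgorithms1997, Table 1] [cite: Miller2011LMS, Def. 1.1] -/
theorem bsdp_two_100719a1_of_flatCountColemanKato
    (hmod : nonempty_modularParametrizationData)
    (hGZK : rank_eq_analyticRank_of_analyticRank_le_one)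
    (h124 : Kato2004.thm12_4) (hX0 : Kato2004_fineSelmerDual_isTorsion)
    (hDD : DokchitserDokchitser2012_surjective_mod_two_four_eight) :
    ∀ (W : WeierstrassCurve ℚ) [W.IsElliptic] [W.IsGloballyMinimal],
      W = (⟨0, 0, 1, -40372074, -98734675687⟩ : WeierstrassCurve ℤ).baseChange ℚ →
    ∀ (κ : ZpExtension ℚ 2) (γ : Field.absoluteGaloisGroup ℚ), κ.IsCyclotomic → κ.IsTopGenerator γ →
    ∀ (v : HeightOneSpectrum (𝓞 ℚ)), (2 : 𝓞 ℚ) ∈ v.asIdeal →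
    ∀ (g : Field.absoluteGaloisGroup (v.adicCompletion ℚ)) (c : ℕ → localPoints W (v.adicCompletion ℚ)),
      κ.IsTopGenerator (resGalOfEmb (closureEmb (K := ℚ) (v.adicCompletion ℚ)) g) →
    (∀ n, c n ∈ localLayerPointsOfEmb κ (closureEmb (K := ℚ) (v.adicCompletion ℚ)) W n) →
    (∀ n, 1 ≤ n → localTraceOfEmb κ (closureEmb (K := ℚ) (v.adicCompletion ℚ)) W n (n + 1)
      (c (n + 1)) = W.frobeniusTrace 2 • c n - c (n - 1)) →
    (∀ z₀ : localLayerPointsOfEmb κ (closureEmb (K := ℚ) (v.adicCompletion ℚ)) W 0 →+ ℤ_[2],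
      evalOn W (localLayerPointsOfEmb κ (closureEmb (K := ℚ) (v.adicCompletion ℚ)) W 0) z₀ (c 0) = 0 →
        z₀ = 0) →
    (∀ a : ℤ_[2],
      (∃ z₀ : localLayerPointsOfEmb κ (closureEmb (K := ℚ) (v.adicCompletion ℚ)) W 0 →+ ℤ_[2],
        evalOn W (localLayerPointsOfEmb κ (closureEmb (K := ℚ) (v.adicCompletion ℚ)) W 0) z₀ (c 0) =
          2 * a) →
      ∃ y : localLayerPointsOfEmb κ (closureEmb (K := ℚ) (v.adicCompletion ℚ)) W 0 →+ ℤ_[2],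
        evalOn W (localLayerPointsOfEmb κ (closureEmb (K := ℚ) (v.adicCompletion ℚ)) W 0) y (c 0) = a) →
    (Finite (W.selmerGroupPInfty 2) →
      Finite (EndCoinvariants (conjSharpFlatSelmerInfty W κ (closureEmb (K := ℚ) (v.adicCompletion ℚ))
        (W.frobeniusTrace 2) g c .flat γ - 1)) →
      Nat.card (↥((sharpFlatSelmerInfty W κ (closureEmb (K := ℚ) (v.adicCompletion ℚ))
            (W.frobeniusTrace 2) g c .flat).comap (W.layerToInfty κ 0)) ⧸
          (W.selmerLayer κ 0).addSubgroupOf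
            ((sharpFlatSelmerInfty W κ (closureEmb (K := ℚ) (v.adicCompletion ℚ))
              (W.frobeniusTrace 2) g c .flat).comap (W.layerToInfty κ 0))) *
        Nat.card (MulAction.fixedPoints (Field.absoluteGaloisGroup ℚ) (W.geomPrimaryTorsion 2)) =
      2 ^ (padicValNat 2 W.tamagawaProduct) *
        Nat.card (EndCoinvariants (conjSharpFlatSelmerInfty W κ
          (closureEmb (K := ℚ) (v.adicCompletion ℚ)) (W.frobeniusTrace 2) g c .flat γ - 1))) →
    (∀ [NeZero (W.conductorNorm ℤ)] (f : CuspForm (Gamma0 (W.conductorNorm ℤ)) 2),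
        IsNewformOf W f → ∀ (ϖ : ℚ), (ϖ : ℝ) * W.realPeriodRat = plusPeriod f →
      ∀ (Ls Lf : IwasawaAlgebra 2), IsSprungPair f 2 (W.frobeniusTrace 2) Ls Lf →
      ∀ (D : SharpFlatSelmerDualData W κ γ (closureEmb (K := ℚ) (v.adicCompletion ℚ))
          (W.frobeniusTrace 2) g c .flat)
        [ContinuousSMul ℤ_[2] (W.tateModule 2)],
        ∃ (I : Kato2004.IwasawaH1Data W 2 κ γ) (Y : W.FineSelmerDualData κ γ)
          (P : Submodule (IwasawaAlgebra 2) (IwasawaAlgebra 2))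
          (loc : I.H →ₗ[IwasawaAlgebra 2] P) (toX : P →ₗ[IwasawaAlgebra 2] D.X)
          (δ : D.X →ₗ[IwasawaAlgebra 2] Y.X) (Z : Submodule (IwasawaAlgebra 2) I.H)
          (G : IwasawaAlgebra 2),
          Function.Exact loc toX ∧ Function.Exact toX δ ∧
          G ∈ Submodule.map (P.subtype ∘ₗ loc) Z ∧
          iwasawaToPowerSeries 2 G = PowerSeries.C (ϖ : ℚ_[2]) * iwasawaToPowerSeries 2 Lf ∧
          (∀ 𝔭 : PrimeSpectrum (IwasawaAlgebra 2), 𝔭.asIdeal.height = 1 →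
            PowerSeries.C (2 : ℤ_[2]) ∉ 𝔭.asIdeal →
            Literature.NumberTheory.EllipticCurves.Module.lengthAt (IwasawaAlgebra 2) Y.X 𝔭 ≤
              Literature.NumberTheory.EllipticCurves.Module.lengthAt (IwasawaAlgebra 2) (I.H ⧸ Z) 𝔭) ∧
          (TwoAdicSurjective W →
            ∀ 𝔭 : PrimeSpectrum (IwasawaAlgebra 2), 𝔭.asIdeal.height = 1 →
              PowerSeries.C (2 : ℤ_[2]) ∈ 𝔭.asIdeal →
              Literature.NumberTheory.EllipticCurves.Module.lengthAt (IwasawaAlgebra 2) Y.X 𝔭 ≤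
                Literature.NumberTheory.EllipticCurves.Module.lengthAt (IwasawaAlgebra 2) (I.H ⧸ Z) 𝔭)) →
    W.entireLFunction 1 ≠ 0 → shaAn W = ((16 : ℕ) : ℚ) → 2 ^ 4 ∣ W.shaOrder → BSDp W 2 :=
  bsdp_two_baseChange_int_of_flatCountColemanKato_zero _ SSColemanRoad.M100719a1_b.1 SSColemanRoad.M100719a1_b.2.1
    SSColemanRoad.M100719a1_b.2.2 SSColemanRoad.M100719a1_Δ SSColemanRoad.M100719a1_c₄ (by decide)
    SSColemanRoad.card_F2_100719a1 (n := 21769416769536) (d := 31) (by decide) (by norm_num)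
    (ℓ₁ := 7) (ℓ₂ := 5) (ℓ₃ := 4) (ℓ₄ := 5) (by norm_num)
    (by decide) (by decide) (by decide) (by decide) (Q := 16) (m := 4) (by decide) (by decide)
    hmod hGZK h124 hX0 hDD

end SSFlatRoad
end Summit.BirchSwinnertonDyer.BirchSwinnertonDyer.Theorems

end
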